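import Mathlib.Analysis.Asymptotics.SuperpolynomialDecay
import Mathlib.Analysis.SpecificLimits.Basic
import Literature.Computability.Cryptography.CryptoFoundationsWave0
import Literature.Computability.Cryptography.StatisticalDistance
import Literature.Computability.Cryptography.OneWayFunctions
import Literature.Computability.Cryptography.Indistinguishability
import Literature.Computability.Cryptography.PseudorandomFunctions
import Literature.Computability.Complexity.TimeBounds
import Literature.Computability.Complexity.BoolEncodings
import Literature.Computability.Complexity.Randomized
import Literature.Computability.Complexity.Oracle
import HarnessLib

-- provenance: harness21/H21/H21/Statements/CryptoFoundations/Pseudorandomness.lean @ 3d603bd (interim HEAD d8f2665); M5 mechanical rewrite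
/-!
# Crypto foundations: pseudorandomness (target statements)

Family `CryptoFoundations`, trunk `CryptoQuantFine` (G11), outline §3
(`CryptoFoundations/Pseudorandomness.lean`). The *definitions* (statistical closeness,
computational indistinguishability, pseudorandom ensembles and generators, next-bit
unpredictability, pseudorandom function ensembles) live in the prelude files
`Literature.Prelude.CryptoQuantFine.StatisticalDistance`, `.Indistinguishability` and
`.PseudorandomFunctions`; this file records the target statements carrying the inventory ids:

* **crypto-foundations.S19** `isStatisticallyClose_iff`: statistical closeness in Goldreich's
  textbook wording `∀ c, ∀ᶠ n, Δ(X n, Y n) < 1/n^c` (real proof, via the auxiliary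
  `isNegligible_iff_eventually_lt_of_nonneg`);
* **crypto-foundations.S20** `isCompIndistinguishable_iff` (Goldreich Def. 3.2.2 wording; real
  proof) and `IsCompIndistinguishableNonuniform.isCompIndistinguishable` (sorry);
* **crypto-foundations.S06** `isPRG_iff` (Goldreich Def. 3.3.1 wording; real proof);
* **crypto-foundations.S07** `PRGExist_iff_OWFExist` (Håstad–Impagliazzo–Levin–Luby 1999,
  Thm. 1.1; sorry);
* **crypto-foundations.S08** `exists_isPRG_of_stretch_succ` (Goldreich Thm. 3.3.3; sorry);
* **crypto-foundations.S21** `isPseudorandom_iff_isNextBitUnpredictable` (Yao 1982; Goldreich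
  Thm. 3.3.7; sorry);
* **crypto-foundations.S09** `PRFExist_of_PRGExist` (Goldreich–Goldwasser–Micali 1986;
  Goldreich Thm. 3.6.6; sorry).

## Design choices

* No new definitions. Negligibility is Wave0's `Literature.Computability.Cryptography.IsNegligible`, a
  reducible abbreviation of Mathlib's `Asymptotics.SuperpolynomialDecay atTop (fun n : ℕ =>
  (n : ℝ))`, so the prelude predicates unfold to it definitionally.
* The textbook wording "for every positive polynomial `p` and all sufficiently large `n`,
  `… < 1/p(n)`" is rendered as `∀ c : ℕ, ∀ᶠ n in atTop, … < 1 / (n : ℝ) ^ c` (monomials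
  suffice). For *nonnegative* sequences this is equivalent to superpolynomial decay
  (`isNegligible_iff_eventually_lt_of_nonneg`, proved here); statistical distance and
  distinguishing advantages are nonnegative, so S19/S20 follow with real proofs.
* S21 (Yao) is stated for an arbitrary ensemble `X` supported on `ℓ n`-bit strings with `ℓ`
  polynomial-time computable in unary (the predictor-to-distinguisher direction pads a prefix
  with `ℓ n - i` fresh coins, so it must compute `ℓ n` from `1ⁿ`); polynomial-time
  samplability of `X` is *not* needed for the uniform random-index predictor form used in the
  prelude (Arora–Barak Thm. 9.11), and is therefore not assumed.
* S08 follows the outline: from a PRG of stretch `n + 1` one obtains a PRG of every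
  polynomially bounded, polynomial-time computable stretch `ℓ` with `n < ℓ n`.
* S09 is GGM with Goldreich's length-preserving convention `κ = ℓin = ℓout = id` (`PRFExist`).

Mathlib anchors used: `Asymptotics.SuperpolynomialDecay`, `Filter.atTop`, `Filter.Eventually`,
`Filter.Tendsto`, `tendsto_inv_atTop_nhds_zero_nat`, `squeeze_zero'`, `Polynomial.eval`,
`PMF.map`, `PMF.support`, `Computability.unaryEncodeNat`. Mathlib has no statistical closeness of
ensembles, computational indistinguishability, PRGs or PRFs (grep for `Indistinguishab`,
`[Pp]seudorandom`, `PRG`, `PRF`, `tvDist` finds nothing relevant).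

## References

* O. Goldreich, *Foundations of Cryptography I: Basic Tools*, CUP 2001: §3.2.1 (Def. 3.2.1,
  statistical closeness), Def. 3.2.2, Def. 3.2.3, Def. 3.3.1, Thm. 3.3.3, Def. 3.3.6,
  Thm. 3.3.7, Thm. 3.5.12, Def. 3.6.4, Thm. 3.6.6.
* J. Håstad, R. Impagliazzo, L. Levin, M. Luby, *A pseudorandom generator from any one-way
  function*, SIAM J. Comput. 28 (1999), Thm. 1.1.
* A. C. Yao, *Theory and applications of trapdoor functions*, FOCS 1982.
* O. Goldreich, S. Goldwasser, S. Micali, *How to construct random functions*, J. ACM 33 (1986).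
* S. Arora, B. Barak, *Computational Complexity: A Modern Approach*, CUP 2009, Thm. 9.11.
-/

namespace Literature.Computability.Cryptography

open Filter Asymptotics Topology _root_.Computability Complexity

/-! ### Negligible nonnegative sequences, textbook form -/

/-- For a nonnegative sequence `μ`, negligibility (superpolynomial decay) is equivalent to the
textbook wording "for every `c`, `μ n < 1/n^c` for all sufficiently large `n`".
[Goldreich 2001, Def. 1.3.5 and the discussion following it] [cite: Goldreich2001, Def. 1.3.5 and the discussion following] -/
theorem isNegligible_iff_eventually_lt_of_nonneg {μ : ℕ → ℝ} (hμ : ∀ n, 0 ≤ μ n) :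
    IsNegligible μ ↔ ∀ c : ℕ, ∀ᶠ n in atTop, μ n < 1 / (n : ℝ) ^ c := by
  constructor
  · intro h c
    have h1 : ∀ᶠ n : ℕ in atTop, (n : ℝ) ^ (c + 1) * μ n < 1 :=
      (h (c + 1)).eventually (gt_mem_nhds zero_lt_one)
    have h2 : ∀ᶠ n : ℕ in atTop, 1 ≤ n := eventually_ge_atTop 1
    filter_upwards [h1, h2] with n h1 h2
    have hn : (1 : ℝ) ≤ n := by exact_mod_cast h2
    have hpos : (0 : ℝ) < (n : ℝ) ^ (c + 1) := by positivity
    have hpos' : (0 : ℝ) < (n : ℝ) ^ c := by positivity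
    calc μ n = (n : ℝ) ^ (c + 1) * μ n / (n : ℝ) ^ (c + 1) := by field_simp
      _ < 1 / (n : ℝ) ^ (c + 1) := by gcongr
      _ ≤ 1 / (n : ℝ) ^ c :=
        one_div_le_one_div_of_le hpos' (pow_le_pow_right₀ hn (Nat.le_succ c))
  · intro h c
    have h2 : ∀ᶠ n : ℕ in atTop, 1 ≤ n := eventually_ge_atTop 1
    refine squeeze_zero' (Eventually.of_forall fun n => mul_nonneg (by positivity) (hμ n)) ?_
      tendsto_inv_atTop_nhds_zero_nat
    filter_upwards [h (c + 1), h2] with n h1 h2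
    have hn : (1 : ℝ) ≤ n := by exact_mod_cast h2
    have hpos : (0 : ℝ) < (n : ℝ) ^ c := by positivity
    calc (n : ℝ) ^ c * μ n ≤ (n : ℝ) ^ c * (1 / (n : ℝ) ^ (c + 1)) := by gcongr
      _ = (n : ℝ)⁻¹ := by rw [pow_succ]; field_simp

/-! ### crypto-foundations.S19: statistical closeness -/

/-- **crypto-foundations.S19** (statistically close ensembles, textbook wording). Two ensembles
`X, Y` are statistically close iff for every `c` and all sufficiently large `n` the statistical
distance `Δ(X n, Y n) = ½ ∑ₐ |Pr[X n = a] - Pr[Y n = a]|` is below `1/n^c` (Goldreich phrases it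
with every positive polynomial `p`, `Δ < 1/p(n)`; monomials suffice). The prelude definition
`IsStatisticallyClose` asks for superpolynomial decay of `n ↦ Δ(X n, Y n)`.
[Goldreich 2001, §3.2.1, Def. 3.2.1 (statistical closeness) and Def. 1.3.5] [cite: Goldreich2001, §3.2.1  Def. 3.2.1 (statistical closenes] -/
theorem isStatisticallyClose_iff {α : Type*} (X Y : Ensemble α) :
    IsStatisticallyClose X Y ↔ ∀ c : ℕ, ∀ᶠ n in atTop, (X n).tvDist (Y n) < 1 / (n : ℝ) ^ c :=
  isNegligible_iff_eventually_lt_of_nonneg fun n => PMF.tvDist_nonneg (X n) (Y n)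

/-! ### crypto-foundations.S20: computational indistinguishability -/

/-- **crypto-foundations.S20** (computational indistinguishability, Goldreich's wording). Two
ensembles `X, Y` on bit strings are computationally indistinguishable iff for every
probabilistic polynomial-time distinguisher `D`, every `c` and all sufficiently large `n`,
`|Pr[D(1ⁿ, X n) = 1] - Pr[D(1ⁿ, Y n) = 1]| < 1/n^c`.
[Goldreich 2001, Def. 3.2.2] [cite: Goldreich2001, Def. 3.2.2] -/
theorem isCompIndistinguishable_iff (X Y : Ensemble (List Bool)) :
    IsCompIndistinguishable X Y ↔
      ∀ D : RandAlg (List Bool) Bool, IsPPT D encodeBool →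
        ∀ c : ℕ, ∀ᶠ n in atTop, distAdvantage D X Y n < 1 / (n : ℝ) ^ c :=
  forall_congr' fun D => forall_congr' fun _ =>
    isNegligible_iff_eventually_lt_of_nonneg fun n => distAdvantage_nonneg D X Y n

/-- **crypto-foundations.S20** (poly-size distinguishers are at least as strong). If `X, Y` are
indistinguishable by non-uniform polynomial-time distinguishers (PPT with polynomial-length
advice, equivalently polynomial-size circuits) then they are indistinguishable by PPT
distinguishers (take empty advice). [Goldreich 2001, Def. 3.2.2, Def. 3.2.3 and the remark
following it] [cite: Goldreich2001, Def. 3.2.2  Def. 3.2.3 and the remark fo] -/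
def IsCompIndistinguishableNonuniform.isCompIndistinguishable : Prop :=
  ∀ {X Y : Ensemble (List Bool)} (h : IsCompIndistinguishableNonuniform X Y),
    IsCompIndistinguishable X Y

/-! ### crypto-foundations.S06: pseudorandom generators -/

/-- **crypto-foundations.S06** (pseudorandom generator, Goldreich's wording). `G` is a
pseudorandom generator with stretch `ℓ` iff `G` is deterministic polynomial-time computable,
`ℓ n > n` for all `n`, `|G s| = ℓ |s|` for all seeds `s`, and for every PPT distinguisher `D`
the gap `n ↦ |Pr[D(1ⁿ, G(U_n)) = 1] - Pr[D(1ⁿ, U_{ℓ n}) = 1]|` is negligible.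
[Goldreich 2001, Def. 3.3.1] [cite: Goldreich2001, Def. 3.3.1] -/
theorem isPRG_iff (G : List Bool → List Bool) (ℓ : ℕ → ℕ) :
    IsPRG G ℓ ↔
      PolyTimeComputable id id G ∧ (∀ n, n < ℓ n) ∧ (∀ s, (G s).length = ℓ s.length) ∧
        ∀ D : RandAlg (List Bool) Bool, IsPPT D encodeBool →
          IsNegligible fun n =>
            |(acceptPMF D n ((uniformBits n).map G) true).toReal -
              (acceptPMF D n (uniformBits (ℓ n)) true).toReal| :=
  Iff.rfl

/-! ### crypto-foundations.S07: PRG exist iff OWF exist -/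

/-- **crypto-foundations.S07** (Håstad–Impagliazzo–Levin–Luby). Pseudorandom generators exist if
and only if one-way functions exist. The direction `→` is elementary (a PRG with stretch `2n`
is one-way); `←` is the HILL construction. [Håstad–Impagliazzo–Levin–Luby 1999, Thm. 1.1;
Goldreich 2001, Thm. 3.5.12] [cite: HastadImpagliazzoLevinLuby1999, Thm. 1.1] -/
def PRGExist_iff_OWFExist : Prop :=
  PRGExist ↔ OWFExist

/-! ### crypto-foundations.S08: stretch amplification -/

/-- **crypto-foundations.S08** (a PRG of stretch `n + 1` yields PRGs of every polynomial
stretch). If there is a pseudorandom generator with stretch `n ↦ n + 1`, then for every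
polynomially bounded stretch function `ℓ` with `n < ℓ n` that is polynomial-time computable in
unary, there is a pseudorandom generator with stretch `ℓ` (iterate the one-bit-stretch generator
`ℓ n` times, outputting one bit per round). [Goldreich 2001, §3.3.2, Construction 3.3.2 and
Thm. 3.3.3] [cite: Goldreich2001, §3.3.2  Construction 3.3.2 and Thm. 3.3] -/
def exists_isPRG_of_stretch_succ : Prop :=
  ∀ (h : ∃ G, IsPRG G (· + 1)) (ℓ : ℕ → ℕ) (hℓ : ∃ p : Polynomial ℕ, ∀ n, ℓ n ≤ p.eval n) (hlt : ∀ n, n < ℓ n) (hcomp : PolyTimeComputable unaryEncodeNat unaryEncodeNat ℓ),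
    ∃ G', IsPRG G' ℓ

/-! ### crypto-foundations.S21: pseudorandomness iff next-bit unpredictability (Yao) -/

/-- **crypto-foundations.S21** (Yao's theorem: pseudorandom iff unpredictable). Let `X` be an
ensemble with `X n` supported on `ℓ n`-bit strings, where `ℓ` is polynomially bounded and
polynomial-time computable in unary. Then `X` is pseudorandom (indistinguishable from
`n ↦ U_{ℓ n}`) iff it passes all polynomial-time next-bit tests. (Polynomial-time samplability
of `X` is not needed for the random-index predictor form `IsNextBitUnpredictable`.)
[Yao 1982; Goldreich 2001, Def. 3.3.6, Thm. 3.3.7; Arora–Barak 2009, Thm. 9.11] [cite: Yao1982] -/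
def isPseudorandom_iff_isNextBitUnpredictable : Prop :=
  ∀ (X : Ensemble (List Bool)) (ℓ : ℕ → ℕ) (hℓ : ∃ p : Polynomial ℕ, ∀ n, ℓ n ≤ p.eval n) (hcomp : PolyTimeComputable unaryEncodeNat unaryEncodeNat ℓ) (hlen : ∀ n, ∀ x ∈ (X n).support, x.length = ℓ n),
    IsPseudorandom X ℓ ↔ IsNextBitUnpredictable X ℓ

/-! ### crypto-foundations.S09: PRG ⇒ PRF (GGM) -/

/-- **crypto-foundations.S09** (Goldreich–Goldwasser–Micali). If pseudorandom generators exist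
then (length-preserving, `κ = ℓin = ℓout = id`) pseudorandom function ensembles exist: from a
length-doubling PRG `G = (G₀, G₁)` put `f_k(x₁⋯xₙ) = G_{xₙ}(⋯ G_{x₁}(k) ⋯)`.
[Goldreich–Goldwasser–Micali 1986, Thm. 3; Goldreich 2001, Construction 3.6.5, Thm. 3.6.6] [cite: GoldreichGoldwasserMicali1986, Thm. 3] -/
def PRFExist_of_PRGExist : Prop :=
  ∀ (h : PRGExist),
    PRFExist

end Literature.Computability.Cryptography
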